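import Mathlib.Analysis.SpecialFunctions.Pow.Real
import Summits.NavierStokesRegularity.Statement
import Literature.Analysis.FluidPDE.ClassicalSolution
import Literature.Analysis.FluidPDE.LerayHopf
import Literature.Analysis.FluidPDE.SuitableWeak
import HarnessLib

/-!
# NavierStokesRegularity — route `TypeICertificateLadder`, support item `LadderGlue`

Settles `stmt-NavierStokesRegularity-2887` (`Theses.TypeICertificateLadder.LadderGlue`), stated
VERBATIM and importing no route (`Theses`) file, so that the gate's `LadderGlue_holds` link can
import this module into the route file without an import cycle (LANDING NOTE in
`Theses/TypeICertificateLadder.lean`, 2026-08-15; pattern of `Theorems/BlowupAssembly.lean` and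
`Theorems/NoBlowupToClay.lean`). The conclusion `NoTypeIBlowup` (= stmt-NavierStokesRegularity-1217,
the route's rank-2 crux) is expanded to its defining Prop, so the statement below is
definitionally the route decl `LadderGlue`.

THE LADDER TEMPLATE. The rung statement `X_C` — an eventual *dimensionless* Type-I rate
`√(T − t) · ‖u(t, x)‖ ≤ C · √ν` for `t ↑ T` forces a classical extension past `T` — for ALL
`C > 0` implies the crux: a Type-I blow-up rate `‖u(t, x)‖ ≤ C′ / √(T − t)` (the tree's
`IsTypeIBlowup`, Leray 1934 §19, KNSS 2009 §1) is the rung hypothesis with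
`C := max (C′ / √ν) 1 > 0`, because `√(T − t) · (C′ / √(T − t)) = C′ ≤ (C′ / √ν) · √ν ≤ C · √ν`
for `t < T`. Pure bookkeeping; no analysis.
-/

namespace Summit.NavierStokesRegularity.NavierStokesRegularity.Theorems

open Filter Topology

/-- **Ladder glue** (item stmt-NavierStokesRegularity-2887, route `TypeICertificateLadder`, stated
verbatim; definitionally `Theses.TypeICertificateLadder.LadderGlue`): if for every `C > 0` the rung
`X_C` holds — every classical solution of unforced Navier–Stokes on `ℝ³ × [0, T)` which is
Leray–Hopf from its rapidly decaying datum and satisfies the eventual dimensionless rate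
`√(T − t)‖u(t, x)‖ ≤ C√ν` extends smoothly past `T` — then there is no Type-I blow-up for Clay
data (`IsTypeIBlowup u T →` smooth extension past `T`). Proof: a Type-I constant `C′` gives the
rung hypothesis with `C := max (C′/√ν) 1`. [folklore bookkeeping; Leray 1934 §19, KNSS 2009 §1
for the Type-I rate] -/
theorem typeICertificateLadder_ladderGlue_proof :
    (∀ C : ℝ, 0 < C → ∀ (ν T : ℝ), 0 < ν → 0 < T → ∀ (u : ℝ → EuclideanSpace ℝ (Fin 3) → EuclideanSpace ℝ (Fin 3)) (p : ℝ → EuclideanSpace ℝ (Fin 3) → ℝ), Literature.Analysis.FluidPDE.IsClassicalNSSolutionOn (Set.Ico 0 T) ν 0 u p → Literature.Analysis.FluidPDE.IsLerayHopfOn T ν 0 (u 0) u → Literature.Analysis.FluidPDE.HasRapidSpatialDecay (u 0) → (∀ᶠ t in 𝓝[<] T, ∀ x, Real.sqrt (T - t) * ‖u t x‖ ≤ C * Real.sqrt ν) → Literature.Analysis.FluidPDE.HasSmoothExtensionPast ν 0 u T) →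
    ∀ (ν T : ℝ), 0 < ν → 0 < T → ∀ (u : ℝ → EuclideanSpace ℝ (Fin 3) → EuclideanSpace ℝ (Fin 3)) (p : ℝ → EuclideanSpace ℝ (Fin 3) → ℝ), Literature.Analysis.FluidPDE.IsClassicalNSSolutionOn (Set.Ico 0 T) ν 0 u p → Literature.Analysis.FluidPDE.IsLerayHopfOn T ν 0 (u 0) u → Literature.Analysis.FluidPDE.HasRapidSpatialDecay (u 0) → Literature.Analysis.FluidPDE.IsTypeIBlowup u T → Literature.Analysis.FluidPDE.HasSmoothExtensionPast ν 0 u T := by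
  intro hR ν T hν hT u p hcl hLH hdec hI
  obtain ⟨C', hC'⟩ := hI
  -- the rung constant
  have hν' : 0 < Real.sqrt ν := Real.sqrt_pos.2 hν
  set C : ℝ := max (C' / Real.sqrt ν) 1 with hCdef
  have hCpos : 0 < C := lt_of_lt_of_le one_pos (le_max_right _ _)
  refine hR C hCpos ν T hν hT u p hcl hLH hdec ?_
  have hlt : ∀ᶠ t in 𝓝[<] T, t < T := self_mem_nhdsWithin
  filter_upwards [hC', hlt] with t ht htT
  intro x
  have hTt : 0 < Real.sqrt (T - t) := Real.sqrt_pos.2 (sub_pos.2 htT)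
  calc Real.sqrt (T - t) * ‖u t x‖
      ≤ Real.sqrt (T - t) * (C' / Real.sqrt (T - t)) :=
        mul_le_mul_of_nonneg_left (ht x) hTt.le
    _ = C' := by field_simp
    _ = (C' / Real.sqrt ν) * Real.sqrt ν := by field_simp
    _ ≤ C * Real.sqrt ν := mul_le_mul_of_nonneg_right (le_max_left _ _) hν'.le

end Summit.NavierStokesRegularity.NavierStokesRegularity.Theorems
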